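import Literature.Probability.ODonnellSaksSchrammServedio2005.StrategyTree
import HarnessLib

/-!
# The O'Donnell–Servedio (OS) inequality on a biased product cube: `∑_{j∈J} Cov[f, x_j] ≤ √(Var f · ∑_{j∈J} δ_j p_j(1−p_j))`

CITATION HEADER. Source: R. O'Donnell, *Analysis of Boolean Functions*, CUP 2014, §8.6, the "OS Inequality"
(R. O'Donnell, R. A. Servedio, *Learning monotone decision trees in polynomial time*, SIAM J. Comput. 37 (2007)):
"Let `f ∈ L²({−1,1}ⁿ, π_p^{⊗n})`. Then `∑_{i=1}^n f̂(i) ≤ ‖f‖₂ · √(Δ_p(f))`", where `f̂(i) = E[f·φ(x_i)]`,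
`φ(x_i) = (x_i − p)/√(p(1−p))`, and `Δ_p(f)` is the expected number of coordinates queried by a decision tree computing
`f`; with the book's proof (p. 232): writing `J` for the random set of queried coordinates,
`∑_i f̂(i) = E[f · ∑_i 𝟙{i ∈ J} φ(x_i)]` because an unqueried coordinate is independent of the transcript, then
Cauchy–Schwarz, and `E[(∑_i 𝟙{i∈J} φ(x_i))²] = ∑_i P[i ∈ J]` because the cross terms vanish.  The same argument
for a SUBSET of the coordinates and coordinate-dependent biases is V. Dewan, S. Muirhead, *Upper bounds on the
one-arm exponent for dependent percolation models*, PTRF (2022), Prop. 2.10, eq. (2.8):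
`|∑_{e∈E'} ∂_{p_e} P_p[A]| ≤ √(P_p[A] · E_p|W_{E'}|)/√(p(1−p))` (`W_{E'}` = revealed coordinates in `E'`; proved there via
relative entropy, Remark 2.12 for the variance route).

What is reproduced here, fully proved, in the finite-sum framework of `BiasedCube.lean` /
`DecisionTreeCovarianceBiased.lean` (finite index type `ι`, biases `p : ι → ℝ`, product weight `wt p`, reduced
deterministic adaptive decision trees `DecTree ι` with real leaf labels, query weights `δ_j^p(T) = DecTree.qprob`):
for every finite `J ⊆ ι` and `f = T.eval`,

  `∑_{j∈J} E_p[f · (𝟙[x_j] − p_j)] ≤ √( Var_p[f] · ∑_{j∈J} δ_j^p(T) · p_j(1 − p_j) )`      (`DecTree.os_sum_cov_le`),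

i.e. the OS inequality with (i) the centred second moment `Var f` in place of `‖f‖₂²` (apply OS to `f − E f`), (ii) an
arbitrary subset `J` of coordinates (Dewan–Muirhead's `E'`), (iii) coordinate-dependent biases; and its query-strategy
form `Strategy.os_sum_cov_le_strategy` (revealment probabilities `Strategy.revealment`).  Ingredients:
`DecTree.sum_wt_queriedCtr_eq_zero` (a queried centred coordinate has mean zero), `DecTree.sum_wt_eval_mul_ctr`
(the OS identity `E[f φ_j] = E[f φ_j 𝟙{j queried}]`), `DecTree.sum_wt_qsum_sq` (`E[(∑_{j∈J} 𝟙{j queried} φ_j)²] =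
∑_{j∈J} δ_j p_j(1−p_j)`).  Everything is finite sums and tree inductions; no measure theory.  Application:
`Literature/Probability/Percolation/SeedCrossingRevealment.lean` (revealment bounds for the derivative of crossing
probabilities, Dewan–Muirhead Prop. 2.2).
-/

namespace Literature.Probability.ODonnellSaksSchrammServedio2005

open Finset Function

variable {ι : Type*}

/-- The centred coordinate `φ_j(x) = 𝟙[x_j] − p_j` of the `p`-biased cube (the numerator of O'Donnell's
`φ(x_i) = (x_i − μ)/σ`). [cite: ODonnell2014, §8.4 Definition 8.40 (the p-biased φ)] -/
noncomputable def ctr (p : ι → ℝ) (j : ι) (x : ι → Bool) : ℝ := (if x j = true then (1 : ℝ) else 0) - p j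

/-- `φ_j` does not read the other coordinates. [cite: ODonnell2014, §8.4 Definition 8.40 (the p-biased φ)] -/
theorem ctr_update_of_ne [DecidableEq ι] (p : ι → ℝ) {i j : ι} (h : j ≠ i) (x : ι → Bool) (c : Bool) :
    ctr p j (update x i c) = ctr p j x := by
  simp [ctr, update_of_ne h]

/-- COVARIANCE WITH A COORDINATE = WEIGHTED PIVOTALITY: `E_p[g · (𝟙[x_e] − p_e)] = p_e(1 − p_e) · E_p[g(x^{e→1}) − g(x^{e→0})]`
(for an increasing Boolean `g` the last expectation is the probability that `e` is pivotal: the Margulis–Russo /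
`p`-biased level-one formula `f̂(i) = σ·E[D_i f]`). [cite: ODonnell2014, §8.4 Prop. 8.45 (f̂(i) = σ E[D_i f] in the p-biased basis)] -/
theorem sum_wt_mul_ctr_eq [Fintype ι] [DecidableEq ι] (p : ι → ℝ) (e : ι) (g : (ι → Bool) → ℝ) :
    ∑ x, wt p x * (g x * ctr p e x)
      = p e * (1 - p e) * ∑ x, wt p x * (g (update x e true) - g (update x e false)) := by
  have hpt : ∀ x : ι → Bool, g x * ctr p e x
      = (if x e = true then (1 - p e) * g (update x e true) else (0 - p e) * g (update x e false)) := by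
    intro x
    rcases Bool.eq_false_or_eq_true (x e) with hx | hx
    · have hu : update x e true = x := by rw [← hx]; exact update_eq_self e x
      simp [ctr, hx, hu]; ring
    · have hu : update x e false = x := by rw [← hx]; exact update_eq_self e x
      simp [ctr, hx, hu]; ring
  simp_rw [hpt]
  rw [sum_wt_ite p e _ _ (fun x c => by simp only [update_idem]) (fun x c => by simp only [update_idem])]
  have e1 : ∑ x, wt p x * ((1 - p e) * g (update x e true)) = (1 - p e) * ∑ x, wt p x * g (update x e true) := by
    rw [Finset.mul_sum]; exact Finset.sum_congr rfl fun x _ => by ring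
  have e0 : ∑ x, wt p x * ((0 - p e) * g (update x e false)) = (0 - p e) * ∑ x, wt p x * g (update x e false) := by
    rw [Finset.mul_sum]; exact Finset.sum_congr rfl fun x _ => by ring
  rw [e1, e0]
  have hsub : ∑ x, wt p x * (g (update x e true) - g (update x e false))
      = ∑ x, wt p x * g (update x e true) - ∑ x, wt p x * g (update x e false) := by
    rw [← Finset.sum_sub_distrib]; exact Finset.sum_congr rfl fun x _ => by ring
  rw [hsub]; ring

namespace DecTree

variable [DecidableEq ι]

/-- A subtree not containing `i` does not read coordinate `i` (evaluation). [folklore] -/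
private theorem eval_update_of_not_mem_vars {T : DecTree ι} {i : ι} (h : i ∉ T.vars) (x : ι → Bool) (c : Bool) :
    T.eval (update x i c) = T.eval x := by
  induction T with
  | leaf v => simp [eval]
  | node j t₀ t₁ ih₀ ih₁ =>
    simp only [vars, Finset.mem_insert, Finset.mem_union, not_or] at h
    obtain ⟨hij, h₀, h₁⟩ := h
    have hj : update x i c j = x j := update_of_ne (fun e => hij e.symm) _ _
    simp only [eval, hj, ih₀ h₀, ih₁ h₁]

/-- A subtree not containing `i` does not read coordinate `i` (queried set). [folklore] -/
private theorem queried_update_of_not_mem_vars {T : DecTree ι} {i : ι} (h : i ∉ T.vars) (x : ι → Bool) (c : Bool) :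
    T.queried (update x i c) = T.queried x := by
  induction T with
  | leaf v => simp [queried]
  | node j t₀ t₁ ih₀ ih₁ =>
    simp only [vars, Finset.mem_insert, Finset.mem_union, not_or] at h
    obtain ⟨hij, h₀, h₁⟩ := h
    have hj : update x i c j = x j := update_of_ne (fun e => hij e.symm) _ _
    simp only [queried, hj, ih₀ h₀, ih₁ h₁]

variable [Fintype ι]

/-- `E_p[φ_j] = 0`: the centred coordinate has mean zero. [cite: ODonnell2014, §8.4 Definition 8.40 (E[φ(x_i)] = 0)] -/
theorem sum_wt_ctr (p : ι → ℝ) (j : ι) : ∑ x, wt p x * ctr p j x = 0 := by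
  have h := sum_wt_mul_coord p j (fun b => (if b = true then (1 : ℝ) else 0) - p j) (fun _ => (1 : ℝ))
    (fun _ _ => rfl)
  simp only [mul_one, sum_wt, if_true, Bool.false_eq_true, if_false] at h
  have h' : ∑ x, wt p x * ctr p j x = ∑ x, wt p x * ((if x j = true then (1 : ℝ) else 0) - p j) := rfl
  rw [h', h]; ring

/-- `E_p[φ_j²] = p_j(1 − p_j)`. [cite: ODonnell2014, §8.4 Definition 8.40 (σ² = p(1−p))] -/
theorem sum_wt_ctr_sq (p : ι → ℝ) (j : ι) : ∑ x, wt p x * ctr p j x ^ 2 = p j * (1 - p j) := by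
  have h := sum_wt_mul_coord p j (fun b => ((if b = true then (1 : ℝ) else 0) - p j) ^ 2) (fun _ => (1 : ℝ))
    (fun _ _ => rfl)
  simp only [mul_one, sum_wt, if_true, Bool.false_eq_true, if_false] at h
  have h' : ∑ x, wt p x * ctr p j x ^ 2 = ∑ x, wt p x * ((if x j = true then (1 : ℝ) else 0) - p j) ^ 2 := rfl
  rw [h', h]; ring

/-- A QUERIED centred coordinate has mean zero: `E_p[𝟙{j queried} · φ_j] = 0` for a reduced tree ("conditioned on
`i` being queried … the conditional distribution of `x_{i'}` remains `π_p`").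
[cite: ODonnell2014, §8.6 proof of the OS Inequality (cross terms vanish)] -/
theorem sum_wt_queriedCtr_eq_zero (p : ι → ℝ) (T : DecTree ι) (hT : T.Reduced) (j : ι) :
    ∑ x, wt p x * (if j ∈ T.queried x then ctr p j x else 0) = 0 := by
  induction T with
  | leaf v => simp [queried]
  | node i t₀ t₁ ih₀ ih₁ =>
    simp only [Reduced] at hT
    obtain ⟨hi₀, hi₁, hr₀, hr₁⟩ := hT
    by_cases hji : j = i
    · subst hji
      have h1 : ∀ x : ι → Bool, (if j ∈ (node j t₀ t₁).queried x then ctr p j x else 0) = ctr p j x := by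
        intro x; simp [queried]
      simp_rw [h1]
      exact sum_wt_ctr p j
    · have h1 : ∀ x : ι → Bool, (if j ∈ (node i t₀ t₁).queried x then ctr p j x else 0)
          = (if x i = true then (if j ∈ t₁.queried x then ctr p j x else 0)
              else (if j ∈ t₀.queried x then ctr p j x else 0)) := by
        intro x
        simp only [queried, Finset.mem_insert, hji, false_or]
        split_ifs <;> simp_all
      simp_rw [h1]
      rw [sum_wt_ite p i _ _
        (fun x c => by rw [queried_update_of_not_mem_vars hi₁, ctr_update_of_ne p hji])
        (fun x c => by rw [queried_update_of_not_mem_vars hi₀, ctr_update_of_ne p hji]),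
        ih₀ hr₀, ih₁ hr₁]
      ring

/-- THE OS IDENTITY: `E_p[f · φ_j] = E_p[f · 𝟙{j queried} · φ_j]` for `f = T.eval`, `T` reduced — an unqueried
coordinate is independent of the leaf ("since `E[φ(x_i)] = 0` for each `i ∉ J` we may continue").
[cite: ODonnell2014, §8.6 proof of the OS Inequality (first display)] -/
theorem sum_wt_eval_mul_ctr (p : ι → ℝ) (T : DecTree ι) (hT : T.Reduced) (j : ι) :
    ∑ x, wt p x * (T.eval x * ctr p j x)
      = ∑ x, wt p x * (T.eval x * (if j ∈ T.queried x then ctr p j x else 0)) := by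
  induction T with
  | leaf v =>
    simp only [eval, queried, Finset.notMem_empty, if_false, mul_zero, Finset.sum_const_zero]
    have : ∑ x, wt p x * (v * ctr p j x) = v * ∑ x, wt p x * ctr p j x := by
      rw [Finset.mul_sum]; exact Finset.sum_congr rfl fun x _ => by ring
    rw [this, sum_wt_ctr, mul_zero]
  | node i t₀ t₁ ih₀ ih₁ =>
    simp only [Reduced] at hT
    obtain ⟨hi₀, hi₁, hr₀, hr₁⟩ := hT
    by_cases hji : j = i
    · subst hji
      refine Finset.sum_congr rfl fun x _ => ?_
      simp [queried]
    · have hL : ∀ x : ι → Bool, (node i t₀ t₁).eval x * ctr p j x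
          = (if x i = true then t₁.eval x * ctr p j x else t₀.eval x * ctr p j x) := by
        intro x; simp only [eval]; split_ifs <;> rfl
      have hR : ∀ x : ι → Bool,
          (node i t₀ t₁).eval x * (if j ∈ (node i t₀ t₁).queried x then ctr p j x else 0)
          = (if x i = true then t₁.eval x * (if j ∈ t₁.queried x then ctr p j x else 0)
              else t₀.eval x * (if j ∈ t₀.queried x then ctr p j x else 0)) := by
        intro x
        simp only [eval, queried, Finset.mem_insert, hji, false_or]
        split_ifs <;> simp_all
      simp_rw [hL, hR]
      rw [sum_wt_ite p i _ _
        (fun x c => by rw [eval_update_of_not_mem_vars hi₁, ctr_update_of_ne p hji])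
        (fun x c => by rw [eval_update_of_not_mem_vars hi₀, ctr_update_of_ne p hji]),
        sum_wt_ite p i _ _
        (fun x c => by rw [eval_update_of_not_mem_vars hi₁, queried_update_of_not_mem_vars hi₁,
          ctr_update_of_ne p hji])
        (fun x c => by rw [eval_update_of_not_mem_vars hi₀, queried_update_of_not_mem_vars hi₀,
          ctr_update_of_ne p hji]),
        ih₀ hr₀, ih₁ hr₁]

/-- The revealment martingale `M_J(x) = ∑_{j∈J} 𝟙{j queried along x} · φ_j(x)` (O'Donnell's
`∑_i 𝟙_{i∈J} φ(x_i)`, restricted to a set `J` of coordinates). [cite: ODonnell2014, §8.6 proof of the OS Inequality (the sum ∑ 1_{i∈J} φ(x_i))] -/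
noncomputable def qsum (p : ι → ℝ) (J : Finset ι) (T : DecTree ι) (x : ι → Bool) : ℝ :=
  ∑ j ∈ J, if j ∈ T.queried x then ctr p j x else 0

/-- `E_p[M_J] = 0`. [cite: ODonnell2014, §8.6 proof of the OS Inequality (cross terms vanish)] -/
theorem sum_wt_qsum (p : ι → ℝ) (J : Finset ι) (T : DecTree ι) (hT : T.Reduced) :
    ∑ x, wt p x * qsum p J T x = 0 := by
  unfold qsum
  simp_rw [Finset.mul_sum]
  rw [Finset.sum_comm]
  exact Finset.sum_eq_zero fun j _ => sum_wt_queriedCtr_eq_zero p T hT j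

omit [Fintype ι] in
/-- The martingale of a node: the root coordinate's term plus the martingale of the branch taken.
[cite: ODonnell2014, §8.6 proof of the OS Inequality (the decision tree process)] -/
theorem qsum_node (p : ι → ℝ) (J : Finset ι) (i : ι) (t₀ t₁ : DecTree ι) (hi₀ : i ∉ t₀.vars)
    (hi₁ : i ∉ t₁.vars) (x : ι → Bool) :
    qsum p J (node i t₀ t₁) x
      = (if i ∈ J then ctr p i x else 0) + (if x i = true then qsum p J t₁ x else qsum p J t₀ x) := by
  unfold qsum
  have hsplit : ∀ j ∈ J, (if j ∈ (node i t₀ t₁).queried x then ctr p j x else 0)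
      = (if j = i then ctr p j x else 0)
        + (if x i = true then (if j ∈ t₁.queried x then ctr p j x else 0)
            else (if j ∈ t₀.queried x then ctr p j x else 0)) := by
    intro j _
    by_cases hji : j = i
    · subst hji
      have h1 : j ∉ t₁.queried x := fun h => hi₁ (queried_subset_vars _ _ h)
      have h0 : j ∉ t₀.queried x := fun h => hi₀ (queried_subset_vars _ _ h)
      simp [queried, h1, h0]
    · simp only [queried, Finset.mem_insert, hji, false_or, if_false, zero_add]
      split_ifs <;> simp_all
  rw [Finset.sum_congr rfl hsplit, Finset.sum_add_distrib, Finset.sum_ite_eq' J i]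
  congr 1
  split_ifs <;> rfl

/-- SECOND MOMENT OF THE REVEALMENT MARTINGALE: `E_p[M_J²] = ∑_{j∈J} δ_j^p(T) · p_j(1 − p_j)` for a reduced tree
(diagonal terms `P[j queried]·E[φ_j²]`, cross terms zero). [cite: ODonnell2014, §8.6 proof of the OS Inequality (E[(∑ 1_{i∈J} φ(x_i))²] = Δ_p(f))] -/
theorem sum_wt_qsum_sq (p : ι → ℝ) (J : Finset ι) (T : DecTree ι) (hT : T.Reduced) :
    ∑ x, wt p x * qsum p J T x ^ 2 = ∑ j ∈ J, T.qprob p j * (p j * (1 - p j)) := by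
  induction T with
  | leaf v => simp [qsum, queried, qprob]
  | node i t₀ t₁ ih₀ ih₁ =>
    simp only [Reduced] at hT
    obtain ⟨hi₀, hi₁, hr₀, hr₁⟩ := hT
    have IH₀ := ih₀ hr₀
    have IH₁ := ih₁ hr₁
    -- expand the square of `A + B`
    set A : (ι → Bool) → ℝ := fun x => if i ∈ J then ctr p i x else 0 with hA
    set B : (ι → Bool) → ℝ := fun x => if x i = true then qsum p J t₁ x else qsum p J t₀ x with hB
    have hsq : ∀ x, qsum p J (node i t₀ t₁) x ^ 2 = A x ^ 2 + 2 * (A x * B x) + B x ^ 2 := by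
      intro x; rw [qsum_node p J i t₀ t₁ hi₀ hi₁ x]; ring
    simp_rw [hsq, mul_add, Finset.sum_add_distrib]
    -- (1) the diagonal term of the root
    have h1 : ∑ x, wt p x * A x ^ 2 = (if i ∈ J then p i * (1 - p i) else 0) := by
      by_cases hiJ : i ∈ J
      · simp only [hA, hiJ, if_true]; exact sum_wt_ctr_sq p i
      · simp [hA, hiJ]
    -- (2) the cross term vanishes
    have hB₁ : ∀ x c, qsum p J t₁ (update x i c) = qsum p J t₁ x := by
      intro x c; unfold qsum
      refine Finset.sum_congr rfl fun j _ => ?_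
      by_cases hji : j = i
      · subst hji
        have h1 : j ∉ t₁.queried x := fun h => hi₁ (queried_subset_vars _ _ h)
        have h1' : j ∉ t₁.queried (update x j c) := fun h => hi₁ (queried_subset_vars _ _ h)
        simp [h1, h1']
      · rw [queried_update_of_not_mem_vars hi₁, ctr_update_of_ne p hji]
    have hB₀ : ∀ x c, qsum p J t₀ (update x i c) = qsum p J t₀ x := by
      intro x c; unfold qsum
      refine Finset.sum_congr rfl fun j _ => ?_
      by_cases hji : j = i
      · subst hji
        have h1 : j ∉ t₀.queried x := fun h => hi₀ (queried_subset_vars _ _ h)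
        have h1' : j ∉ t₀.queried (update x j c) := fun h => hi₀ (queried_subset_vars _ _ h)
        simp [h1, h1']
      · rw [queried_update_of_not_mem_vars hi₀, ctr_update_of_ne p hji]
    have h2 : ∑ x, wt p x * (2 * (A x * B x)) = 0 := by
      by_cases hiJ : i ∈ J
      · have hAB : ∀ x, 2 * (A x * B x)
            = (if x i = true then 2 * (1 - p i) * qsum p J t₁ x else 2 * (0 - p i) * qsum p J t₀ x) := by
          intro x
          simp only [hA, hB, hiJ, if_true, ctr]
          split_ifs <;> ring
        simp_rw [hAB]
        rw [sum_wt_ite p i _ _ (fun x c => by rw [hB₁]) (fun x c => by rw [hB₀])]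
        have e1 : ∑ x, wt p x * (2 * (1 - p i) * qsum p J t₁ x) = 2 * (1 - p i) * ∑ x, wt p x * qsum p J t₁ x := by
          rw [Finset.mul_sum]; exact Finset.sum_congr rfl fun x _ => by ring
        have e0 : ∑ x, wt p x * (2 * (0 - p i) * qsum p J t₀ x) = 2 * (0 - p i) * ∑ x, wt p x * qsum p J t₀ x := by
          rw [Finset.mul_sum]; exact Finset.sum_congr rfl fun x _ => by ring
        rw [e1, e0, sum_wt_qsum p J t₁ hr₁, sum_wt_qsum p J t₀ hr₀]; ring
      · simp [hA, hiJ]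
    -- (3) the branch term
    have h3 : ∑ x, wt p x * B x ^ 2
        = p i * (∑ j ∈ J, t₁.qprob p j * (p j * (1 - p j)))
          + (1 - p i) * ∑ j ∈ J, t₀.qprob p j * (p j * (1 - p j)) := by
      have hB2 : ∀ x, B x ^ 2 = (if x i = true then qsum p J t₁ x ^ 2 else qsum p J t₀ x ^ 2) := by
        intro x; simp only [hB]; split_ifs <;> rfl
      simp_rw [hB2]
      rw [sum_wt_ite p i _ _ (fun x c => by rw [hB₁]) (fun x c => by rw [hB₀]), IH₁, IH₀]
    rw [h1, h2, h3, add_zero]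
    -- bookkeeping of `qprob` at a node
    have h4 : ∑ j ∈ J, (node i t₀ t₁).qprob p j * (p j * (1 - p j))
        = (if i ∈ J then p i * (1 - p i) else 0)
          + (p i * (∑ j ∈ J, t₁.qprob p j * (p j * (1 - p j)))
            + (1 - p i) * ∑ j ∈ J, t₀.qprob p j * (p j * (1 - p j))) := by
      have e : ∀ j ∈ J, (node i t₀ t₁).qprob p j * (p j * (1 - p j))
          = (if j = i then p j * (1 - p j) else 0)
            + (p i * (t₁.qprob p j * (p j * (1 - p j))) + (1 - p i) * (t₀.qprob p j * (p j * (1 - p j)))) := by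
        intro j _
        simp only [qprob]
        split_ifs <;> ring
      rw [Finset.sum_congr rfl e, Finset.sum_add_distrib, Finset.sum_ite_eq' J i, Finset.sum_add_distrib,
        ← Finset.mul_sum, ← Finset.mul_sum]
    rw [h4]

/-- Weighted Cauchy–Schwarz on the biased cube: `E_p[a b] ≤ √(E_p[a²] · E_p[b²])`.
[cite: ODonnell2014, §8.6 proof of the OS Inequality (Cauchy–Schwarz step)] -/
theorem sum_wt_mul_le_sqrt {p : ι → ℝ} (h0 : ∀ i, 0 ≤ p i) (h1 : ∀ i, p i ≤ 1) (a b : (ι → Bool) → ℝ) :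
    ∑ x, wt p x * (a x * b x) ≤ Real.sqrt ((∑ x, wt p x * a x ^ 2) * ∑ x, wt p x * b x ^ 2) := by
  have hcs := Finset.sum_mul_sq_le_sq_mul_sq (Finset.univ : Finset (ι → Bool))
    (fun x => Real.sqrt (wt p x) * a x) (fun x => Real.sqrt (wt p x) * b x)
  have hw : ∀ x, Real.sqrt (wt p x) * Real.sqrt (wt p x) = wt p x :=
    fun x => Real.mul_self_sqrt (wt_nonneg h0 h1 x)
  have e1 : ∑ x, Real.sqrt (wt p x) * a x * (Real.sqrt (wt p x) * b x) = ∑ x, wt p x * (a x * b x) :=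
    Finset.sum_congr rfl fun x _ => by
      rw [show Real.sqrt (wt p x) * a x * (Real.sqrt (wt p x) * b x)
          = (Real.sqrt (wt p x) * Real.sqrt (wt p x)) * (a x * b x) by ring, hw x]
  have e2 : ∑ x, (Real.sqrt (wt p x) * a x) ^ 2 = ∑ x, wt p x * a x ^ 2 :=
    Finset.sum_congr rfl fun x _ => by rw [mul_pow, Real.sq_sqrt (wt_nonneg h0 h1 x)]
  have e3 : ∑ x, (Real.sqrt (wt p x) * b x) ^ 2 = ∑ x, wt p x * b x ^ 2 :=
    Finset.sum_congr rfl fun x _ => by rw [mul_pow, Real.sq_sqrt (wt_nonneg h0 h1 x)]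
  rw [e1, e2, e3] at hcs
  exact (le_abs_self _).trans (Real.abs_le_sqrt hcs)

/-- THE OS INEQUALITY (restricted, biased, centred form): for a reduced tree `T`, biases in `[0,1]`, any finite set
`J` of coordinates and `f = T.eval`,
`∑_{j∈J} E_p[f · (𝟙[x_j] − p_j)] ≤ √( Var_p[f] · ∑_{j∈J} δ_j^p(T) · p_j(1−p_j) )`.
O'Donnell's statement is `J = [n]`, `p_j ≡ p`, with `‖f‖₂ ≥ √Var f`; Dewan–Muirhead's (2.8) is the subset form.
[cite: ODonnell2014, §8.6 OS Inequality (∑_i f̂(i) ≤ ‖f‖₂ √Δ_p(f))] [cite: DewanMuirhead2022, Prop. 2.10 eq. (2.8) (the subset E' of coordinates)] -/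
theorem os_sum_cov_le (p : ι → ℝ) (h0 : ∀ i, 0 ≤ p i) (h1 : ∀ i, p i ≤ 1) (T : DecTree ι) (hT : T.Reduced)
    (J : Finset ι) :
    ∑ j ∈ J, ∑ x, wt p x * (T.eval x * ctr p j x)
      ≤ Real.sqrt ((∑ x, wt p x * (T.eval x - ∑ y, wt p y * T.eval y) ^ 2)
          * ∑ j ∈ J, T.qprob p j * (p j * (1 - p j))) := by
  set E : ℝ := ∑ y, wt p y * T.eval y with hE
  -- `∑_j E[f φ_j] = E[f · M_J] = E[(f − E f) · M_J]`
  have step1 : ∑ j ∈ J, ∑ x, wt p x * (T.eval x * ctr p j x) = ∑ x, wt p x * (T.eval x * qsum p J T x) := by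
    rw [Finset.sum_congr rfl (fun j _ => sum_wt_eval_mul_ctr p T hT j), Finset.sum_comm]
    refine Finset.sum_congr rfl fun x _ => ?_
    rw [qsum, Finset.mul_sum, Finset.mul_sum]
  have step2 : ∑ x, wt p x * (T.eval x * qsum p J T x) = ∑ x, wt p x * ((T.eval x - E) * qsum p J T x) := by
    have : ∑ x, wt p x * ((T.eval x - E) * qsum p J T x)
        = ∑ x, wt p x * (T.eval x * qsum p J T x) - E * ∑ x, wt p x * qsum p J T x := by
      rw [Finset.mul_sum, ← Finset.sum_sub_distrib]
      exact Finset.sum_congr rfl fun x _ => by ring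
    rw [this, sum_wt_qsum p J T hT, mul_zero, sub_zero]
  rw [step1, step2]
  refine (sum_wt_mul_le_sqrt h0 h1 _ _).trans (le_of_eq ?_)
  rw [sum_wt_qsum_sq p J T hT]

end DecTree

namespace Strategy

variable [DecidableEq ι] [Fintype ι]

/-- THE OS INEQUALITY FOR A QUERY STRATEGY: if the legal strategy `S` with labels `L` computes `g`, then for every
finite set `J` of coordinates,
`∑_{j∈J} E_p[g · (𝟙[x_j] − p_j)] ≤ √( Var_p[g] · ∑_{j∈J} P_p(j queried) · p_j(1−p_j) )`
— the total (restricted) correlation of `g` with the coordinates is controlled by the revealment of the algorithm.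
[cite: ODonnell2014, §8.6 OS Inequality] [cite: DewanMuirhead2022, Prop. 2.10 eq. (2.8)] -/
theorem os_sum_cov_le_strategy (p : ι → ℝ) (h0 : ∀ i, 0 ≤ p i) (h1 : ∀ i, p i ≤ 1)
    {S : (ι → Option Bool) → Option ι} (hS : Legal S) (L : (ι → Option Bool) → ℝ)
    {g : (ι → Bool) → ℝ} (hL : ∀ σ x, Consistent σ x → S σ = none → L σ = g x) (J : Finset ι) :
    ∑ j ∈ J, ∑ x, wt p x * (g x * ctr p j x)
      ≤ Real.sqrt ((∑ x, wt p x * (g x - ∑ y, wt p y * g y) ^ 2)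
          * ∑ j ∈ J, revealment p S L j * (p j * (1 - p j))) := by
  have hev : ∀ y, (tree S L).eval y = g y := eval_tree_eq hS hL
  have hred : (tree S L).Reduced := reduced_build hS L _ _
  have key := DecTree.os_sum_cov_le p h0 h1 (tree S L) hred J
  simp only [hev] at key
  refine key.trans (le_of_eq ?_)
  congr 1; congr 1
  refine Finset.sum_congr rfl fun j _ => ?_
  rw [DecTree.qprob_eq_sum_queried p _ hred, revealment]

end Strategy

end Literature.Probability.ODonnellSaksSchrammServedio2005
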